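import Mathlib.MeasureTheory.Function.JacobianOneDim
import Literature.Geometry.ComplexHyperbolic.UnitBallPolarCoordinates
import Literature.Geometry.ComplexHyperbolic.UnitBallNegativeLineProjector
import Literature.AlgebraicGeometry.ShimuraVarieties.UnitaryBallGroupIntegralRecord
import HarnessLib

/-!
# The blow-up substitution for `K`-central ball averages (ROAD A (A3-b), analytic toolkit II)

For a test function `Θ` on `M₃(ℂ)`, `u, η ∈ ℂ` and `ε > 0` consider the BALL AVERAGE of the affine pencil of rank-one idempotents
(★ `UnitBallKCentralOrbitalIntegral`: these are the `K`-central orbital integrals of `U(2,1)`)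
`I(ε) = ∫_{𝔹²} Θ(u•1 + (εη)•P(lift z)) dβ(z)`, `dβ = 9(1−|z|²)⁻³dz` (★ `BallForms.bergmanVolume`), `P(lift z) = Q(lift z)⁻¹·(lift z)(lift z)*J`.
Reading `β` in polar coordinates (★ `UnitBallPolarCoordinates`) and substituting the BLOW-UP COORDINATE `s = ε ∕ (1 − r²)` along each ray
(one monotone change of variables `Ioo 0 1 → Ioi ε`, Mathlib `integral_image_eq_integral_abs_deriv_smul`) gives the EXACT identity

  `ε² · I(ε) = (9∕2) ∫_σ ∫_{s>ε} (s − ε) · Θ(u•1 − (sη)•N(√(1−ε∕s)·ω, 1)) ds dσ(ω)`,  `N(w) = w w* J`,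

which exhibits `ε²` as the normaliser and the cone `{−s•N(ω,1)}` (square-zero rank one, ★ `UnitBallNegativeLineProjector`) as the limit
support.  §1 the (2,2)-entry bookkeeping and the support radius of a compactly supported `Θ`; §2 the ray identity (pure change of
variables, no hypothesis on `Θ`); §3 the assembled identity.

References: Rogawski 1990 §8.4 pp. 126–127 (normalisation of the singular orbital integrals at the compact wall); Rudin 1980 §1.4
(polar coordinates), §2.2 (the invariant measure of the ball); Helgason 2000 Ch. I §1 No. 2; Goldman 1999 §3.1.
HONEST LABEL: HC_CM is proved only modulo the printed citations until rung 0 closes; this file is real analysis over ★ ball-model files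
and pays nothing by itself.
-/

noncomputable section

open MeasureTheory MeasureTheory.Measure Set Matrix Complex ComplexConjugate
open Literature.AlgebraicGeometry.ShimuraVarieties.BallForms

namespace Literature.Geometry.ComplexHyperbolic.BallModel

/-! ### §1 Bookkeeping: the chart vector `(w₀, w₁, 1)`, its `(2,2)` entry, support radius -/

/-- `Q(w₀, w₁, 1) = |w|² − 1`. [cite: Jacobowitz1990, Ch. 2 §1] -/
theorem Q_vecCons_one (w : Fin 2 → ℂ) : Q ![w 0, w 1, 1] = nsq w - 1 := by
  simp only [Q, cons_val_zero, cons_val_one, cons_val, norm_one, one_pow, nsq]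

/-- The `(2,2)` entry of `N(w₀, w₁, 1) = (w,1)(w,1)*J` is `−1`, whatever `w`. [cite: Goldman1999, §3.1.1] -/
theorem vecMulVec_vecCons_one_mul_J_apply_two_two (w : Fin 2 → ℂ) :
    (vecMulVec ![w 0, w 1, 1] (star ![w 0, w 1, 1]) * J) 2 2 = -1 := by
  rw [vecMulVec_star_mul_J_apply]
  simp [J]

/-- **SUPPORT RADIUS**: a compactly supported `Θ` vanishes at `u•1 + Y` as soon as the `(2,2)` entry of `Y` is large:
`∃ R > 0, ‖Y₂₂‖ ≥ R ⇒ Θ(u•1 + Y) = 0`. [cite: Rudin1980, §1.4] -/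
theorem exists_radius_apply_add_eq_zero {G : Type*} [Zero G] [TopologicalSpace G] (Θ : Matrix (Fin 3) (Fin 3) ℂ → G)
    (hΘc : HasCompactSupport Θ) (u : ℂ) :
    ∃ R : ℝ, 0 < R ∧ ∀ Y : Matrix (Fin 3) (Fin 3) ℂ, R ≤ ‖Y 2 2‖ → Θ (u • (1 : Matrix (Fin 3) (Fin 3) ℂ) + Y) = 0 := by
  obtain ⟨M, hM⟩ := hΘc.isCompact.exists_bound_of_continuousOn
    ((continuous_id.matrix_elem (2 : Fin 3) (2 : Fin 3)).continuousOn : ContinuousOn (fun X : Matrix (Fin 3) (Fin 3) ℂ => X 2 2) (tsupport Θ))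
  refine ⟨max M 0 + ‖u‖ + 1, by positivity, fun Y hY => image_eq_zero_of_notMem_tsupport fun hmem => ?_⟩
  have h1 : ‖(u • (1 : Matrix (Fin 3) (Fin 3) ℂ) + Y) 2 2‖ ≤ M := hM _ hmem
  have h2 : (u • (1 : Matrix (Fin 3) (Fin 3) ℂ) + Y) 2 2 = u + Y 2 2 := by simp
  rw [h2] at h1
  have h3 : ‖Y 2 2‖ ≤ ‖u + Y 2 2‖ + ‖u‖ := by
    calc ‖Y 2 2‖ = ‖(u + Y 2 2) - u‖ := by rw [add_sub_cancel_left]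
      _ ≤ ‖u + Y 2 2‖ + ‖u‖ := norm_sub_le _ _
  linarith [le_max_left M 0]

/-! ### §2 The ray identity: the substitution `s = ε ∕ (1 − r²)` -/

/-- **THE BLOW-UP SUBSTITUTION ALONG A RAY** (`|ω|² = 1`, `ε > 0`, any `Θ`): with `N(w) = (w,1)(w,1)*J`, `P = Q⁻¹N`,
`∫_{0<r<1} r³ · 9(1−|rω|²)⁻³ · Θ(u•1 + (εη)•P(rω,1)) dr = (9 ∕ (2ε²)) ∫_{s>ε} (s−ε) · Θ(u•1 − (sη)•N(√(1−ε∕s)ω, 1)) ds`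
(change of variables `s = ε∕(1−r²)`, `ds = 2εr(1−r²)⁻² dr`, and `(εη)•P(rω,1) = −(εη∕(1−r²))•N(rω,1)`). [cite: Rogawski1990, §8.4 pp. 126–127] [cite: Rudin1980, §1.4] -/
theorem setIntegral_Ioo_bergman_pencil_ray_eq {G : Type*} [NormedAddCommGroup G] [NormedSpace ℝ G]
    (Θ : Matrix (Fin 3) (Fin 3) ℂ → G) (u η : ℂ) {ω : Fin 2 → ℂ} (hω : nsq ω = 1) {ε : ℝ} (hε : 0 < ε) :
    ∫ r in Ioo (0 : ℝ) 1, r ^ 3 • ((9 * ((1 - nsq (r • ω))⁻¹) ^ 3) • Θ (u • (1 : Matrix (Fin 3) (Fin 3) ℂ) + ((ε : ℂ) * η) •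
        ((((Q ![(r • ω) 0, (r • ω) 1, 1] : ℝ) : ℂ))⁻¹ • (vecMulVec ![(r • ω) 0, (r • ω) 1, 1] (star ![(r • ω) 0, (r • ω) 1, 1]) * J)))) =
      (9 / (2 * ε ^ 2)) • ∫ s in Ioi ε, (s - ε) • Θ (u • (1 : Matrix (Fin 3) (Fin 3) ℂ) - (((s : ℝ) : ℂ) * η) •
        (vecMulVec ![(Real.sqrt (1 - ε / s) • ω) 0, (Real.sqrt (1 - ε / s) • ω) 1, 1]
          (star ![(Real.sqrt (1 - ε / s) • ω) 0, (Real.sqrt (1 - ε / s) • ω) 1, 1]) * J)) := by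
  set φ : ℝ → ℝ := fun r => ε * (1 - r ^ 2)⁻¹ with hφ
  set φ' : ℝ → ℝ := fun r => ε * (2 * r / (1 - r ^ 2) ^ 2) with hφ'
  have hderiv : ∀ r ∈ Ioo (0 : ℝ) 1, HasDerivWithinAt φ (φ' r) (Ioo 0 1) r := by
    intro r hr
    have ht : (1 - r ^ 2) ≠ 0 := by nlinarith [hr.1, hr.2]
    have h1 : HasDerivAt (fun r : ℝ => 1 - r ^ 2) (-(2 * r)) r := by
      simpa using (hasDerivAt_pow 2 r).const_sub 1
    have h2 := (h1.inv ht).const_mul ε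
    refine (h2.congr_deriv ?_).hasDerivWithinAt
    rw [hφ', neg_neg]
  have hinj : InjOn φ (Ioo 0 1) := by
    intro a ha b hb h
    have ha' : (1 - a ^ 2) ≠ 0 := by nlinarith [ha.1, ha.2]
    have hb' : (1 - b ^ 2) ≠ 0 := by nlinarith [hb.1, hb.2]
    have h' : (1 - a ^ 2)⁻¹ = (1 - b ^ 2)⁻¹ := mul_left_cancel₀ hε.ne' h
    rw [_root_.inv_inj] at h'
    exact (pow_left_inj₀ ha.1.le hb.1.le two_ne_zero).1 (by linarith)
  have himage : φ '' Ioo 0 1 = Ioi ε := by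
    ext s
    constructor
    · rintro ⟨r, hr, rfl⟩
      have ht0 : 0 < 1 - r ^ 2 := by nlinarith [hr.1, hr.2]
      have ht1 : 1 - r ^ 2 < 1 := by nlinarith [hr.1, hr.2]
      exact lt_mul_of_one_lt_right hε ((one_lt_inv₀ ht0).2 ht1)
    · intro hs
      have hs0 : 0 < s := hε.trans hs
      have hq0 : 0 < 1 - ε / s := by rw [sub_pos, div_lt_one hs0]; exact hs
      have hq1 : 1 - ε / s < 1 := by have := div_pos hε hs0; linarith
      refine ⟨Real.sqrt (1 - ε / s), ⟨Real.sqrt_pos.2 hq0, (Real.sqrt_lt' one_pos).2 (by simpa using hq1)⟩, ?_⟩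
      simp only [hφ, Real.sq_sqrt hq0.le, sub_sub_cancel]
      field_simp
  rw [← himage, integral_image_eq_integral_abs_deriv_smul measurableSet_Ioo hderiv hinj, ← integral_smul]
  refine setIntegral_congr_fun measurableSet_Ioo fun r hr => ?_
  have hr0 : 0 < r := hr.1
  have ht : 0 < 1 - r ^ 2 := by nlinarith [hr.1, hr.2]
  have hnsq : nsq (r • ω) = r ^ 2 := by rw [nsq_real_smul, hω, mul_one]
  have hQ : Q ![(r • ω) 0, (r • ω) 1, 1] = r ^ 2 - 1 := by rw [Q_vecCons_one, hnsq]
  have hsq : Real.sqrt (1 - ε / φ r) = r := by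
    have : 1 - ε / φ r = r ^ 2 := by
      simp only [hφ]
      field_simp
      ring
    rw [this, Real.sqrt_sq hr0.le]
  have habs : |φ' r| = φ' r := abs_of_pos (by simp only [hφ']; positivity)
  simp only [hsq, habs, hnsq, hQ]
  have htc : ((r ^ 2 - 1 : ℝ) : ℂ) ≠ 0 := by exact_mod_cast (by linarith : (r ^ 2 - 1 : ℝ) ≠ 0)
  have hN : ((ε : ℂ) * η) • ((((r ^ 2 - 1 : ℝ) : ℂ))⁻¹ • (vecMulVec ![(r • ω) 0, (r • ω) 1, 1] (star ![(r • ω) 0, (r • ω) 1, 1]) * J)) =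
      -(((((φ r : ℝ)) : ℂ) * η) • (vecMulVec ![(r • ω) 0, (r • ω) 1, 1] (star ![(r • ω) 0, (r • ω) 1, 1]) * J)) := by
    have hc1 : (1 - (r : ℂ) ^ 2) ≠ 0 := by exact_mod_cast (ht.ne' : (1 - r ^ 2 : ℝ) ≠ 0)
    have hc2 : ((r : ℂ) ^ 2 - 1) ≠ 0 := by
      intro h; apply hc1; linear_combination -h
    rw [smul_smul, ← neg_smul]
    congr 1
    simp only [hφ]
    push_cast
    field_simp
    ring
  have hε' : ε ≠ 0 := hε.ne'
  have ht' : (1 - r ^ 2) ≠ 0 := ht.ne'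
  rw [hN, ← sub_eq_add_neg, smul_smul, smul_smul, smul_smul]
  congr 1
  simp only [hφ, hφ']
  field_simp
  ring

/-! ### §3 The assembled identity -/

/-- **`ε²` IS THE NORMALISER — THE BLOW-UP SUBSTITUTION FOR `K`-CENTRAL BALL AVERAGES**: for `Θ` continuous with compact support, `u ∈ ℂ`,
`η ≠ 0`, `ε > 0` and any angular measure `σ` of ★ `exists_angularMeasure` (`hσ`, `hσ1`):
`ε² · ∫_{𝔹²} Θ(u•1 + (εη)•P(lift z)) dβ(z) = (9∕2) ∫_σ ∫_{s>ε} (s−ε) · Θ(u•1 − (sη)•N(√(1−ε∕s)ω, 1)) ds dσ(ω)`.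
[cite: Rogawski1990, §8.4 pp. 126–127] [cite: Rudin1980, §1.4, §2.2] [cite: Helgason2000, Ch. I §1 No. 2] -/
theorem sq_smul_integral_bergmanVolume_pencil_eq {G : Type*} [NormedAddCommGroup G] [NormedSpace ℝ G]
    {σ : Measure (Fin 2 → ℂ)} [SFinite σ]
    (hσ : (σ.prod (volumeIoiPow 3)).map (fun p : (Fin 2 → ℂ) × Ioi (0 : ℝ) => (p.2 : ℝ) • p.1) = volume)
    (hσ1 : ∀ᵐ ω ∂σ, nsq ω = 1)
    (Θ : Matrix (Fin 3) (Fin 3) ℂ → G) (hΘ : Continuous Θ) (hΘc : HasCompactSupport Θ) (u : ℂ) {η : ℂ} (hη : η ≠ 0) {ε : ℝ} (hε : 0 < ε) :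
    ε ^ 2 • (∫ z, Θ (u • (1 : Matrix (Fin 3) (Fin 3) ℂ) + ((ε : ℂ) * η) •
        ((((Q (lift z) : ℝ) : ℂ))⁻¹ • (vecMulVec (lift z) (star (lift z)) * J))) ∂bergmanVolume) =
      (9 / 2 : ℝ) • ∫ ω, (∫ s in Ioi ε, (s - ε) • Θ (u • (1 : Matrix (Fin 3) (Fin 3) ℂ) - (((s : ℝ) : ℂ) * η) •
        (vecMulVec ![(Real.sqrt (1 - ε / s) • ω) 0, (Real.sqrt (1 - ε / s) • ω) 1, 1]
          (star ![(Real.sqrt (1 - ε / s) • ω) 0, (Real.sqrt (1 - ε / s) • ω) 1, 1]) * J))) ∂σ := by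
  -- the ambient integrand
  set F : (Fin 2 → ℂ) → G := fun w => (9 * ((1 - nsq w)⁻¹) ^ 3).toNNReal • Θ (u • (1 : Matrix (Fin 3) (Fin 3) ℂ) + ((ε : ℂ) * η) •
    ((((Q ![w 0, w 1, 1] : ℝ) : ℂ))⁻¹ • (vecMulVec ![w 0, w 1, 1] (star ![w 0, w 1, 1]) * J))) with hF
  -- Step 1: `dβ = density • d(ballVolume)`, read through the ambient `F`
  have h1 : ∫ z, Θ (u • (1 : Matrix (Fin 3) (Fin 3) ℂ) + ((ε : ℂ) * η) •
        ((((Q (lift z) : ℝ) : ℂ))⁻¹ • (vecMulVec (lift z) (star (lift z)) * J))) ∂bergmanVolume = ∫ z, F z.1 ∂ballVolume := by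
    have hd : Measurable fun z : Ball => (bergmanDensity z).toNNReal := measurable_bergmanDensity.real_toNNReal
    simp only [bergmanVolume, ENNReal.ofReal]
    rw [integral_withDensity_eq_integral_smul hd]
    rfl
  -- Step 2: support radius and sup bound of `Θ`; integrability of `F` on the ball
  obtain ⟨R, hR, hRΘ⟩ := exists_radius_apply_add_eq_zero Θ hΘc u
  obtain ⟨C, hC⟩ := hΘc.exists_bound_of_continuous hΘ
  have hηpos : 0 < ‖η‖ := norm_pos_iff.2 hη
  -- on the ball, the integrand vanishes unless `1 - |w|² ≥ ε‖η‖/R`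
  have hvan : ∀ w : Fin 2 → ℂ, nsq w < 1 → 1 - nsq w < ε * ‖η‖ / R →
      Θ (u • (1 : Matrix (Fin 3) (Fin 3) ℂ) + ((ε : ℂ) * η) •
        ((((Q ![w 0, w 1, 1] : ℝ) : ℂ))⁻¹ • (vecMulVec ![w 0, w 1, 1] (star ![w 0, w 1, 1]) * J))) = 0 := by
    intro w hw hsmall
    apply hRΘ
    have h22 : ((((Q ![w 0, w 1, 1] : ℝ) : ℂ))⁻¹ • (vecMulVec ![w 0, w 1, 1] (star ![w 0, w 1, 1]) * J)) 2 2 =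
        ((((1 - nsq w : ℝ))⁻¹ : ℝ) : ℂ) := pencil_lift_apply_two_two ⟨w, hw⟩
    have hpos : 0 < 1 - nsq w := by linarith
    rw [Matrix.smul_apply, h22, smul_eq_mul, norm_mul, norm_mul, Complex.norm_real, Complex.norm_real, Real.norm_eq_abs,
      Real.norm_eq_abs, abs_of_pos hε, abs_of_pos (inv_pos.2 hpos)]
    have h' := (lt_div_iff₀ hR).1 hsmall
    rw [← div_eq_mul_inv, le_div_iff₀ hpos]
    nlinarith
  have hFint : IntegrableOn F {w | nsq w < 1} := by
    have hB : MeasurableSet {w : Fin 2 → ℂ | nsq w < 1} := measurableSet_setOf_nsq_lt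
    have hcont : ContinuousOn F {w | nsq w < 1} := by
      have hL : Continuous fun w : Fin 2 → ℂ => (![w 0, w 1, 1] : Fin 3 → ℂ) :=
        (continuous_apply 0).matrixVecCons ((continuous_apply 1).matrixVecCons continuous_const)
      have hN : Continuous fun w : Fin 2 → ℂ => vecMulVec ![w 0, w 1, 1] (star ![w 0, w 1, 1]) * J :=
        continuous_vecMulVec_star_mul_J.comp hL
      have hQc : Continuous fun w : Fin 2 → ℂ => ((Q ![w 0, w 1, 1] : ℝ) : ℂ) := by
        refine Complex.continuous_ofReal.comp ?_
        simp only [Q_vecCons_one]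
        exact continuous_fun_nsq.sub continuous_const
      have hQi : ContinuousOn (fun w : Fin 2 → ℂ => (((Q ![w 0, w 1, 1] : ℝ) : ℂ))⁻¹) {w | nsq w < 1} :=
        hQc.continuousOn.inv₀ fun w hw => by
          rw [Q_vecCons_one]; exact_mod_cast (by simp only [mem_setOf_eq] at hw; linarith : nsq w - 1 ≠ 0)
      have hsub : ContinuousOn (fun w : Fin 2 → ℂ => 1 - nsq w) {w | nsq w < 1} := (continuous_const.sub continuous_fun_nsq).continuousOn
      have hdens : ContinuousOn (fun w : Fin 2 → ℂ => (9 * ((1 - nsq w)⁻¹) ^ 3).toNNReal) {w | nsq w < 1} := by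
        refine continuous_real_toNNReal.comp_continuousOn (continuousOn_const.mul ((hsub.inv₀ fun w hw => ?_).pow 3))
        simp only [mem_setOf_eq] at hw
        exact (by linarith : (1 - nsq w : ℝ) ≠ 0)
      have hP : ContinuousOn (fun w : Fin 2 → ℂ => (((Q ![w 0, w 1, 1] : ℝ) : ℂ))⁻¹ • (vecMulVec ![w 0, w 1, 1] (star ![w 0, w 1, 1]) * J))
          {w | nsq w < 1} := hQi.smul hN.continuousOn
      have hP1 : ContinuousOn (fun w : Fin 2 → ℂ => ((ε : ℂ) * η) •
          ((((Q ![w 0, w 1, 1] : ℝ) : ℂ))⁻¹ • (vecMulVec ![w 0, w 1, 1] (star ![w 0, w 1, 1]) * J))) {w | nsq w < 1} :=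
        hP.const_smul ((ε : ℂ) * η)
      have hP2 : ContinuousOn (fun w : Fin 2 → ℂ => u • (1 : Matrix (Fin 3) (Fin 3) ℂ) + ((ε : ℂ) * η) •
          ((((Q ![w 0, w 1, 1] : ℝ) : ℂ))⁻¹ • (vecMulVec ![w 0, w 1, 1] (star ![w 0, w 1, 1]) * J))) {w | nsq w < 1} :=
        continuousOn_const.add hP1
      exact hdens.smul (hΘ.comp_continuousOn hP2)
    refine ⟨hcont.aestronglyMeasurable hB, HasFiniteIntegral.restrict_of_bounded ((9 * ((ε * ‖η‖ / R)⁻¹) ^ 3) * C)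
      volume_setOf_nsq_lt_lt_top ((ae_restrict_iff' hB).2 (Filter.Eventually.of_forall fun w hw => ?_))⟩
    simp only [mem_setOf_eq] at hw
    by_cases hsmall : 1 - nsq w < ε * ‖η‖ / R
    · simp only [hF, hvan w hw hsmall, smul_zero, norm_zero]
      have : 0 ≤ C := (norm_nonneg _).trans (hC 0)
      positivity
    · rw [not_lt] at hsmall
      have hpos : 0 < 1 - nsq w := by linarith
      have hq : 0 < ε * ‖η‖ / R := by positivity
      simp only [hF, NNReal.smul_def, norm_smul, Real.coe_toNNReal _ (by positivity : (0:ℝ) ≤ 9 * ((1 - nsq w)⁻¹) ^ 3)]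
      rw [Real.norm_of_nonneg (by positivity : (0:ℝ) ≤ 9 * ((1 - nsq w)⁻¹) ^ 3)]
      have hC0 : 0 ≤ C := (norm_nonneg _).trans (hC 0)
      have hinv : (1 - nsq w)⁻¹ ≤ (ε * ‖η‖ / R)⁻¹ := inv_anti₀ hq hsmall
      have hinv0 : 0 ≤ (1 - nsq w)⁻¹ := inv_nonneg.2 hpos.le
      calc 9 * ((1 - nsq w)⁻¹) ^ 3 * ‖Θ _‖ ≤ 9 * ((ε * ‖η‖ / R)⁻¹) ^ 3 * C := by
            gcongr
            exact hC _
        _ = 9 * ((ε * ‖η‖ / R)⁻¹) ^ 3 * C := rfl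
  -- Step 3: polar coordinates on the ball
  have h3 := integral_ballVolume_eq_integral_polar hσ hσ1 F hFint
  -- Step 4: the ray identity for a.e. `ω`
  have h4 : ∀ᵐ ω ∂σ, ∫ r in Ioo (0 : ℝ) 1, r ^ 3 • F (r • ω) = (9 / (2 * ε ^ 2)) • ∫ s in Ioi ε, (s - ε) •
      Θ (u • (1 : Matrix (Fin 3) (Fin 3) ℂ) - (((s : ℝ) : ℂ) * η) •
        (vecMulVec ![(Real.sqrt (1 - ε / s) • ω) 0, (Real.sqrt (1 - ε / s) • ω) 1, 1]
          (star ![(Real.sqrt (1 - ε / s) • ω) 0, (Real.sqrt (1 - ε / s) • ω) 1, 1]) * J)) := by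
    refine hσ1.mono fun ω hω => ?_
    rw [← setIntegral_Ioo_bergman_pencil_ray_eq Θ u η hω hε]
    refine setIntegral_congr_fun measurableSet_Ioo fun r hr => ?_
    have hnsq : nsq (r • ω) = r ^ 2 := by rw [nsq_real_smul, hω, mul_one]
    have hpos : (0 : ℝ) ≤ 9 * ((1 - nsq (r • ω))⁻¹) ^ 3 := by
      rw [hnsq]; have : 0 < 1 - r ^ 2 := by nlinarith [hr.1, hr.2]
      positivity
    simp only [hF, NNReal.smul_def, Real.coe_toNNReal _ hpos]
  rw [h1, h3, integral_congr_ae h4, integral_smul, smul_smul]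
  congr 1
  field_simp

end Literature.Geometry.ComplexHyperbolic.BallModel

end
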